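import Summits.CriticalPhenomena.Ising3DConformalLimit.Theorems.HyperoctahedralRPExistsScaleCovariantLimitFoldedCurrentUniqueness
import Summits.CriticalPhenomena.Ising3DConformalLimit.Theses.MonotoneRG
import HarnessLib

/-!
# Split glue for the shared crux `ExistsScaleCovariantLimit` at route `MonotoneRG`'s copy
# (item stmt-CriticalPhenomena-1981; registered sub-goals `ExistsScaleCovariantLimit_of_subs`,
# `ExistsScaleCovariantLimit_iff_subs`, `subs_of_existsScaleCovariantLimit`)

The shared existence crux `ExistsScaleCovariantLimit` (existence of the full pointwise scaling limit of the
critical `ℤ³` Ising correlators — normalised, non-degenerate, translation invariant, scale covariant;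
Duminil-Copin, ICM 2022 §8.4, "widely open") is, kernel-checked, EXACTLY the conjunction of two existing
ledger items (`FoldedCurrentRepulsion.crux_iff_doubling_and_totallyDisconnected`, p139907, stated on route
`HyperoctahedralRP`'s copy):

* item stmt-CriticalPhenomena-6150 `MirrorHoelderCompactness.TwoPointDoubling` (all-scale doubling of the axial
  critical two-point function — the compactness half; Aizenman–Duminil-Copin 2021 Remark 5.10, open);
* item stmt-CriticalPhenomena-4659 `ClusterRigidity.ClusterSetTotallyDisconnected` (the identification half).

This file lands the three sub-goals the crux-strategist (s1, 2026-08-17) registered on item 1981 for the route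
split `ExistsScaleCovariantLimit ⟶ TwoPointDoubling ∧ ClusterSetTotallyDisconnected` at route `MonotoneRG`'s
copy of the shared decl, EXACTLY as registered: the arrow form a split consumes
(`ExistsScaleCovariantLimit_of_subs`), the exactness `↔` (`ExistsScaleCovariantLimit_iff_subs`) and the necessity
of both children (`subs_of_existsScaleCovariantLimit`, the refuter entry point). All route copies of the decl
have one body, so the `HyperoctahedralRP`-typed terms of p139907 are accepted at the `MonotoneRG` type by
`δ`-unfolding (as for the `GaussianScaleMixture` / `PositivityBegetsConformality` copies in
`Lines/folded_current_repulsion.lean` v7/v8). Composition of landed theorems only; nothing is weakened or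
strengthened; no definitions.

References: H. Duminil-Copin, ICM 2022, §8.4 [DuminilCopinICM2022]; M. Aizenman, H. Duminil-Copin, Ann. of
Math. 194 (2021), arXiv:1912.07973, Remark 5.10 [AizenmanDuminilCopinAnnals2021].
-/

namespace Summit.CriticalPhenomena.Ising3DConformalLimit.Cruxes.ExistsScaleCovariantLimit.MonotoneRGSplit

open Summit.CriticalPhenomena.Ising3DConformalLimit.Theses
open Summit.CriticalPhenomena.Ising3DConformalLimit.Cruxes.ExistsScaleCovariantLimit.FoldedCurrentRepulsion
  (crux_iff_doubling_and_totallyDisconnected)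

/-- **EXACTNESS of the split at route `MonotoneRG`'s copy** (registered sub-goal
`ExistsScaleCovariantLimit_iff_subs` of item 1981): the crux is equivalent to item 6150 ∧ item 4659
(p139907 transported by `δ`-unfolding). [folklore] -/
theorem ExistsScaleCovariantLimit_iff_subs : Summit.CriticalPhenomena.Ising3DConformalLimit.Theses.MonotoneRG.ExistsScaleCovariantLimit ↔ Summit.CriticalPhenomena.Ising3DConformalLimit.Theses.MirrorHoelderCompactness.TwoPointDoubling ∧ Summit.CriticalPhenomena.Ising3DConformalLimit.Theses.ClusterRigidity.ClusterSetTotallyDisconnected :=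
  crux_iff_doubling_and_totallyDisconnected

/-- **SPLIT GLUE at route `MonotoneRG`'s copy** (registered sub-goal `ExistsScaleCovariantLimit_of_subs` of item
1981): item 6150 `TwoPointDoubling` and item 4659 `ClusterSetTotallyDisconnected` give the crux. [folklore] -/
theorem ExistsScaleCovariantLimit_of_subs : Summit.CriticalPhenomena.Ising3DConformalLimit.Theses.MirrorHoelderCompactness.TwoPointDoubling → Summit.CriticalPhenomena.Ising3DConformalLimit.Theses.ClusterRigidity.ClusterSetTotallyDisconnected → Summit.CriticalPhenomena.Ising3DConformalLimit.Theses.MonotoneRG.ExistsScaleCovariantLimit :=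
  fun hD hT => ExistsScaleCovariantLimit_iff_subs.2 ⟨hD, hT⟩

/-- **NECESSITY of both children at route `MonotoneRG`'s copy** (registered sub-goal
`subs_of_existsScaleCovariantLimit` of item 1981; the refuter entry point: refuting either child refutes the
crux). [folklore] -/
theorem subs_of_existsScaleCovariantLimit : Summit.CriticalPhenomena.Ising3DConformalLimit.Theses.MonotoneRG.ExistsScaleCovariantLimit → Summit.CriticalPhenomena.Ising3DConformalLimit.Theses.MirrorHoelderCompactness.TwoPointDoubling ∧ Summit.CriticalPhenomena.Ising3DConformalLimit.Theses.ClusterRigidity.ClusterSetTotallyDisconnected :=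
  ExistsScaleCovariantLimit_iff_subs.1

end Summit.CriticalPhenomena.Ising3DConformalLimit.Cruxes.ExistsScaleCovariantLimit.MonotoneRGSplit
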